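import Mathlib.Analysis.Distribution.TestFunction
import Summits.RiemannHypothesis.RiemannHypothesis.Theorems.SoloInformedWeilSurface

/-!
# AWS / Tautological — the axiom list of an arithmetic Weil surface is satisfiable iff RH (cc-4)

HONEST LABEL (mandatory on every AWS file).  The sprint's theorem
`Nonempty ArithmeticWeilSurface → RiemannHypothesis` is a one-way implication from a strengthened,
prime-side-only axiom system; the existence of such an object is NOT claimed and is the located gap.
THIS FILE is the honesty audit of that label, in the kernel: on the sprint's test class
`𝓓((⊤ : Opens ℝ), ℝ)` (real smooth compactly supported functions, Mathlib `TestFunction`, LF topology)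
the axiom list — an `ℝ`-valued symmetric pairing `inter` on a real vector space, isotropic fibres
`e₁, e₂` with `inter e₁ e₂ = 1`, an `ℝ`-LINEAR graph map `corr`, the PRIME-SIDE intersection numbers
`corr φ · corr ψ = Re φ̂(0) Re ψ̂(1) + Re φ̂(1) Re ψ̂(0) - Re W(φ ⋆ ψ̃)`, `corr φ · e₁ = Re φ̂(1)`,
`corr φ · e₂ = Re φ̂(0)` (here for ALL tests, a fortiori on any generating family), continuity of
`u ↦ corr u · x`, and Hodge-index negativity on `(e₁ + e₂)^⊥` (hence on `span(e₁,e₂)^⊥`) — is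
SATISFIABLE AS SOON AS WEIL POSITIVITY HOLDS (`exists_tautologicalCarrier_of_weilPositivity`), by the
TAUTOLOGICAL CARRIER `V := 𝓓 × ℝ × ℝ`, `corr u := (u, 0, 0)`, `e₁ := (0, 1, 0)`, `e₂ := (0, 0, 1)` and the
pairing DECREED by the prime-side numbers; on `(e₁ + e₂)^⊥` one computes
`x · x = -Re Q(u) - 2 (a + Re û(0))²` for `x = (u, a, b)`.  Consequently
(`riemannHypothesis_iff_exists_tautologicalCarrier`) the axiom list is satisfiable IFF RH, given only
that the prime-side packaging maps exist (DOWN-1/DOWN-2 of `AWS/Forcing.lean`: bilinearity and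
LF-continuity of `Re W(u ⋆ ṽ)`, `Re û(0)`, `Re û(1)` — analytic facts independent of RH).

READING (labels: PROVED for the two theorems, DERIVED for this paragraph).  Removing every zero-side
number from the structure (REFEREE-1 D26 (b)) does NOT make `Nonempty ArithmeticWeilSurface` weaker
than RH: like `WeilSurface` (T53, `riemannHypothesis_iff_nonempty_weilSurface`) and the six carriers of
`located_objects_tfae`, any structure whose fields are among the axioms above is EQUIVALENT to RH, the
converse being tautological rather than "zero-built".  What the strengthening "prime-side generators +
continuity + forcing" buys is a constraint on the FORM of a realisation (linear in the test function,
determined by countably many prime-side identities), not on its existence.  The located gap is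
therefore, precisely: an INDEPENDENT (geometric / Arakelov-theoretic) construction of `(V, inter, corr)`
in which Hodge-index negativity is a theorem about `V` — e.g. an arithmetic Hodge index theorem à la
Faltings–Hriljac on an actual square of `Spec ℤ` — and not a decree.  Fields that WOULD break the
tautology are exactly the ones no known object supplies: integrality of `inter` on the lattice spanned
by `e₁, e₂, corr(G)` (unsatisfiable as typed: the prescribed values are transcendental), or finite rank
of `V` (DERIVED: incompatible with the identities for all tests, Weil's form having infinite rank).
Cell framing: lottery ticket at the motivic door; RH probability negligible; consolation prizes are
real: a new semi-local Weil-positivity theorem, or a located gap in the Connes–Consani programme, plus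
the ff-door theorem.

(Filed under `Theorems/MotivicDoor/AWS/` because the filing seat is a planner; namespace
`Summit.RiemannHypothesis.MotivicDoor.AWS`.)  References: A. Weil (1948); E. Bombieri, Rend. Mat. Acc.
Lincei (9) 11 (2000) Thm 2; A. Connes, C. Consani, arXiv:1805.10501 §3.1; G. Faltings, Ann. of Math. 119
(1984) §5 (arithmetic Hodge index); P. Hriljac, Amer. J. Math. 107 (1985).
-/

noncomputable section

open Complex Set TopologicalSpace Literature.NumberTheory.LFunctions
open Summit.RiemannHypothesis.RiemannHypothesis.Theorems
open scoped ComplexConjugate Distributions ContDiff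

namespace Summit.RiemannHypothesis.MotivicDoor.AWS

/-- **The tautological carrier.**  If Weil positivity holds, then for ANY prime-side packaging
(`𝔴 u v = Re W(u ⋆ ṽ)`, `m₀ u = Re û(0)`, `m₁ u = Re û(1)`, linear, continuous in `u`) the full axiom
list of an arithmetic Weil surface is satisfied on `V := 𝓓 × ℝ × ℝ` with `corr u = (u,0,0)`,
`e₁ = (0,1,0)`, `e₂ = (0,0,1)`: symmetry; `e₁² = e₂² = 0`, `e₁·e₂ = 1`; Hodge-index negativity on
`(e₁ + e₂)^⊥` AND on `span(e₁,e₂)^⊥`; continuity of `u ↦ corr u · corr v`, `u ↦ corr u · eᵢ`; and the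
three prime-side intersection identities for ALL pairs of tests.  No zero of `ζ` enters the
construction; RH enters only through `0 ≤ Re Q(u) = 𝔴 u u`. -/
theorem exists_tautologicalCarrier_of_weilPositivity (hW : WeilPositivity)
    (𝔴 : 𝓓((⊤ : Opens ℝ), ℝ) →ₗ[ℝ] 𝓓((⊤ : Opens ℝ), ℝ) →ₗ[ℝ] ℝ)
    (m₀ m₁ : 𝓓((⊤ : Opens ℝ), ℝ) →ₗ[ℝ] ℝ)
    (h𝔴 : ∀ u v, 𝔴 u v =
      (weilFunctional (weilConv (fun t ↦ ((u t : ℝ) : ℂ)) (weilReflect fun t ↦ ((v t : ℝ) : ℂ)))).re)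
    (h𝔴c : ∀ v, Continuous fun u ↦ 𝔴 u v) (hm₀c : Continuous m₀) (hm₁c : Continuous m₁) :
    ∃ (inter : LinearMap.BilinForm ℝ (𝓓((⊤ : Opens ℝ), ℝ) × ℝ × ℝ))
      (e₁ e₂ : 𝓓((⊤ : Opens ℝ), ℝ) × ℝ × ℝ)
      (corr : 𝓓((⊤ : Opens ℝ), ℝ) →ₗ[ℝ] 𝓓((⊤ : Opens ℝ), ℝ) × ℝ × ℝ),
      (∀ x y, inter x y = inter y x) ∧ inter e₁ e₁ = 0 ∧ inter e₂ e₂ = 0 ∧ inter e₁ e₂ = 1 ∧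
      (∀ D, inter D (e₁ + e₂) = 0 → inter D D ≤ 0) ∧
      (∀ D, inter D e₁ = 0 → inter D e₂ = 0 → inter D D ≤ 0) ∧
      (∀ v, Continuous fun u ↦ inter (corr u) (corr v)) ∧
      (Continuous fun u ↦ inter (corr u) e₁) ∧ (Continuous fun u ↦ inter (corr u) e₂) ∧
      (∀ φ ψ, inter (corr φ) (corr ψ) = m₀ φ * m₁ ψ + m₁ φ * m₀ ψ - 𝔴 φ ψ) ∧
      (∀ φ, inter (corr φ) e₁ = m₁ φ) ∧ (∀ φ, inter (corr φ) e₂ = m₀ φ) := by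
  -- Weil positivity on the test class: `0 ≤ Re Q(u) = 𝔴 u u`
  have hWu : ∀ u : 𝓓((⊤ : Opens ℝ), ℝ), 0 ≤ 𝔴 u u := fun u ↦ by
    rw [h𝔴]
    exact hW _ ⟨ofRealCLM.contDiff.comp u.contDiff,
      u.hasCompactSupport.comp_left (g := ofReal) ofReal_zero⟩
  -- symmetry of `Re W(u ⋆ ṽ)` for real tests (a theorem: `W` is even)
  have h𝔴s : ∀ u v : 𝓓((⊤ : Opens ℝ), ℝ), 𝔴 u v = 𝔴 v u := fun u v ↦ by
    rw [h𝔴, h𝔴, weilFunctional_weilConv_weilReflect_swap_of_real (u := fun t ↦ ((v t : ℝ) : ℂ))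
      (v := fun t ↦ ((u t : ℝ) : ℂ)) (fun t ↦ conj_ofReal _) (fun t ↦ conj_ofReal _)]
  -- the decreed pairing on `𝓓 × ℝ × ℝ`
  obtain ⟨inter, hI⟩ : ∃ inter : LinearMap.BilinForm ℝ (𝓓((⊤ : Opens ℝ), ℝ) × ℝ × ℝ), ∀ x y,
      inter x y = m₀ x.1 * m₁ y.1 + m₁ x.1 * m₀ y.1 - 𝔴 x.1 y.1 + x.2.1 * y.2.2 + x.2.2 * y.2.1 +
        x.2.1 * m₁ y.1 + y.2.1 * m₁ x.1 + x.2.2 * m₀ y.1 + y.2.2 * m₀ x.1 :=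
    ⟨LinearMap.mk₂ ℝ (fun x y ↦ m₀ x.1 * m₁ y.1 + m₁ x.1 * m₀ y.1 - 𝔴 x.1 y.1 + x.2.1 * y.2.2 +
        x.2.2 * y.2.1 + x.2.1 * m₁ y.1 + y.2.1 * m₁ x.1 + x.2.2 * m₀ y.1 + y.2.2 * m₀ x.1)
      (fun x x' y ↦ by
        simp only [Prod.fst_add, Prod.snd_add, map_add, LinearMap.add_apply]; ring)
      (fun c x y ↦ by
        simp only [Prod.smul_fst, Prod.smul_snd, map_smul, LinearMap.smul_apply, smul_eq_mul]; ring)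
      (fun x y y' ↦ by
        simp only [Prod.fst_add, Prod.snd_add, map_add]; ring)
      (fun c x y ↦ by
        simp only [Prod.smul_fst, Prod.smul_snd, map_smul, smul_eq_mul]; ring),
      fun x y ↦ rfl⟩
  refine ⟨inter, (0, 1, 0), (0, 0, 1), LinearMap.inl ℝ _ _, fun x y ↦ ?_, ?_, ?_, ?_, fun D hD ↦ ?_,
    fun D h₁ h₂ ↦ ?_, fun v ↦ ?_, ?_, ?_, fun φ ψ ↦ ?_, fun φ ↦ ?_, fun φ ↦ ?_⟩
  · rw [hI, hI, h𝔴s x.1 y.1]; ring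
  · simp [hI]
  · simp [hI]
  · simp [hI]
  · -- Hodge index on `(e₁ + e₂)^⊥`: `D·D = -𝔴 u u - 2 (a + m₀ u)²`
    have hD' : D.2.1 + D.2.2 + m₁ D.1 + m₀ D.1 = 0 := by
      simpa [hI, map_add] using hD
    have hsq : inter D D = -(𝔴 D.1 D.1) - 2 * (D.2.1 + m₀ D.1) ^ 2 := by
      rw [hI]; linear_combination (2 * (D.2.1 + m₀ D.1)) * hD'
    rw [hsq]
    nlinarith [hWu D.1, sq_nonneg (D.2.1 + m₀ D.1)]
  · -- Hodge index on `span(e₁,e₂)^⊥`: `D·D = -𝔴 u u`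
    have h₁' : D.2.2 + m₁ D.1 = 0 := by simpa [hI] using h₁
    have h₂' : D.2.1 + m₀ D.1 = 0 := by simpa [hI] using h₂
    have hsq : inter D D = -(𝔴 D.1 D.1) := by
      rw [hI]; linear_combination (2 * (m₀ D.1 + D.2.1)) * h₁'
    rw [hsq]
    linarith [hWu D.1]
  · have h : (fun u ↦ inter (LinearMap.inl ℝ _ _ u) (LinearMap.inl ℝ _ _ v)) =
        fun u ↦ m₀ u * m₁ v + m₁ u * m₀ v - 𝔴 u v := funext fun u ↦ by simp [hI]
    rw [h]
    exact ((hm₀c.mul continuous_const).add (hm₁c.mul continuous_const)).sub (h𝔴c v)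
  · have h : (fun u ↦ inter (LinearMap.inl ℝ _ _ u) (0, 1, 0)) = fun u ↦ m₁ u :=
      funext fun u ↦ by simp [hI]
    rw [h]; exact hm₁c
  · have h : (fun u ↦ inter (LinearMap.inl ℝ _ _ u) (0, 0, 1)) = fun u ↦ m₀ u :=
      funext fun u ↦ by simp [hI]
    rw [h]; exact hm₀c
  · simp [hI]
  · simp [hI]
  · simp [hI]

/-- **The AWS axiom list is satisfiable iff RH** (given the prime-side packaging maps).  `→`: RH gives
Weil positivity (`weil_criterion_holds`) and the tautological carrier
(`exists_tautologicalCarrier_of_weilPositivity`).  `←`: the identities for all tests and Hodge-index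
negativity give Castelnuovo–Severi `corr u · corr u ≤ 2 (corr u · e₁)(corr u · e₂)`
(`inter_self_le_two_mul_of_hodge`), i.e. `Re Q(u) ≥ 0` for every real test, i.e. Weil positivity
(`weilPositivity_iff_real`), i.e. RH.  The sprint's structure asks the identities only on a
generating family and recovers them for all tests by the forcing lemma (`AWS/Forcing.lean`); its
`Nonempty` is therefore equivalent to RH as well. -/
theorem riemannHypothesis_iff_exists_tautologicalCarrier
    (𝔴 : 𝓓((⊤ : Opens ℝ), ℝ) →ₗ[ℝ] 𝓓((⊤ : Opens ℝ), ℝ) →ₗ[ℝ] ℝ)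
    (m₀ m₁ : 𝓓((⊤ : Opens ℝ), ℝ) →ₗ[ℝ] ℝ)
    (h𝔴 : ∀ u v, 𝔴 u v =
      (weilFunctional (weilConv (fun t ↦ ((u t : ℝ) : ℂ)) (weilReflect fun t ↦ ((v t : ℝ) : ℂ)))).re)
    (hm₀ : ∀ u, m₀ u = (weilMellin (fun t ↦ ((u t : ℝ) : ℂ)) 0).re)
    (hm₁ : ∀ u, m₁ u = (weilMellin (fun t ↦ ((u t : ℝ) : ℂ)) 1).re)
    (h𝔴c : ∀ v, Continuous fun u ↦ 𝔴 u v) (hm₀c : Continuous m₀) (hm₁c : Continuous m₁) :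
    RiemannHypothesis ↔
      ∃ (inter : LinearMap.BilinForm ℝ (𝓓((⊤ : Opens ℝ), ℝ) × ℝ × ℝ))
        (e₁ e₂ : 𝓓((⊤ : Opens ℝ), ℝ) × ℝ × ℝ)
        (corr : 𝓓((⊤ : Opens ℝ), ℝ) →ₗ[ℝ] 𝓓((⊤ : Opens ℝ), ℝ) × ℝ × ℝ),
        (∀ x y, inter x y = inter y x) ∧ inter e₁ e₁ = 0 ∧ inter e₂ e₂ = 0 ∧ inter e₁ e₂ = 1 ∧
        (∀ D, inter D (e₁ + e₂) = 0 → inter D D ≤ 0) ∧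
        (∀ D, inter D e₁ = 0 → inter D e₂ = 0 → inter D D ≤ 0) ∧
        (∀ v, Continuous fun u ↦ inter (corr u) (corr v)) ∧
        (Continuous fun u ↦ inter (corr u) e₁) ∧ (Continuous fun u ↦ inter (corr u) e₂) ∧
        (∀ φ ψ, inter (corr φ) (corr ψ) = m₀ φ * m₁ ψ + m₁ φ * m₀ ψ - 𝔴 φ ψ) ∧
        (∀ φ, inter (corr φ) e₁ = m₁ φ) ∧ (∀ φ, inter (corr φ) e₂ = m₀ φ) := by
  refine ⟨fun hRH ↦ exists_tautologicalCarrier_of_weilPositivity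
      ((show RiemannHypothesis ↔ WeilPositivity from weil_criterion_holds).1 hRH) 𝔴 m₀ m₁ h𝔴 h𝔴c hm₀c
      hm₁c, ?_⟩
  rintro ⟨inter, e₁, e₂, corr, hsymm, he₁, he₂, he₁₂, hodge, -, -, -, -, hself, hf₁, hf₂⟩
  refine (show RiemannHypothesis ↔ WeilPositivity from weil_criterion_holds).2
    (weilPositivity_iff_real.2 fun u hu ↦ ?_)
  -- the real Weil test `u` as an element of the test class
  have hcd : ContDiff ℝ ∞ u := by
    have h := reCLM.contDiff.comp hu.1
    have hfun : (⇑reCLM ∘ fun t ↦ ((u t : ℝ) : ℂ)) = u := funext fun t ↦ by simp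
    rwa [hfun] at h
  have hcs : HasCompactSupport u := by
    have h := hu.2.comp_left (g := Complex.re) Complex.zero_re
    have hfun : (Complex.re ∘ fun t ↦ ((u t : ℝ) : ℂ)) = u := funext fun t ↦ by simp
    rwa [hfun] at h
  set T : 𝓓((⊤ : Opens ℝ), ℝ) := ⟨u, hcd, hcs, by simp⟩ with hT
  have hTu : ⇑T = u := rfl
  -- Castelnuovo–Severi at the graph of `T`
  have hCS := inter_self_le_two_mul_of_hodge inter hsymm he₁ he₂ he₁₂ hodge (corr T)
  rw [hself, hf₁, hf₂, hm₀, hm₁, h𝔴, hTu] at hCS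
  have hQ : (weilQuadratic fun t ↦ ((u t : ℝ) : ℂ)).re =
      (weilFunctional (weilConv (fun t ↦ ((u t : ℝ) : ℂ)) (weilReflect fun t ↦ ((u t : ℝ) : ℂ)))).re :=
    rfl
  rw [hQ]
  nlinarith [hCS]

end Summit.RiemannHypothesis.MotivicDoor.AWS

end
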